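import Mathlib.Topology.MetricSpace.Cauchy
import Mathlib.Topology.MetricSpace.Basic
import Mathlib.Topology.UniformSpace.UniformEmbedding
import Mathlib.Order.Filter.Ultrafilter.Basic
import Mathlib.Analysis.SpecificLimits.Basic
import HarnessLib

/-!
# Ultralimits of pointed metric spaces

The tool behind Gromov's precompactness theorem in its pointed form (`PointedGHPrecompactness.lean`)
and hence behind the first assertion of Huang–Huang–Wang–Zhu 2026, Thm 2.1 (arXiv:2605.24380, §2.1
p. 6: "passing to a subsequence if necessary, `(Xᵢ, pᵢ, Gᵢ) → (X, p, G)`"), for the NONCOMPACT covers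
`(M̂ᵢ, p̂ᵢ)` of §4 p. 13: given pointed pseudometric spaces `(Xᵢ, pᵢ)` and an ultrafilter `U` on `ℕ`,
the *ultralimit* is the metric quotient of the space of sequences `xᵢ ∈ Xᵢ` at bounded distance
from the base points, with the distance `lim_U d(xᵢ, yᵢ)`. (The tree's
`MetricGeometry/EquivariantGHLimit.lean` uses `U`-limits inside a FIXED compact space; here the
spaces vary and are unbounded.)

* §1 `ulimReal U a` — the `U`-limit of a bounded real sequence (`limUnder`), with its calculus
  (`tendsto_ulimReal`, constants, sums, order, `ε`-closeness `U`-almost everywhere);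
* §2 `PreUltralimit p U` — admissible sequences with the pseudometric `lim_U d(xᵢ, yᵢ)`
  (`instPseudoMetricSpace`), the base point, `tendsto_dist`;
* §3 `PreUltralimit.completeSpace` — **ultralimits are complete** (for `U` finer than the cofinite
  filter: fast Cauchy sequences converge, by a diagonal choice of representatives);
* §4 `Ultralimit p U` — the metric (separation) quotient, a complete metric space with base point
  `Ultralimit.basePt`.

Everything here is a definition with body or a proved theorem; no named facts.

## References

* M. Gromov, *Groups of polynomial growth and expanding maps*, Publ. IHÉS 53 (1981) 53–78
  (precompactness; limits of pointed spaces). (Context.)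
* H. Huang, X.-T. Huang, J. Wang, X. Zhu, arXiv:2605.24380 (2026), §2.1 p. 6, Thm 2.1; §4 p. 13.
  [HuangHuangWangZhu2026]
-/

noncomputable section

open Set Filter Metric Topology

namespace Literature.Geometry.MetricGeometry

/-! ### §1. `U`-limits of bounded real sequences -/

section ULim

variable (U : Ultrafilter ℕ)

/-- The `U`-limit of a real sequence (meaningful for bounded sequences, `tendsto_ulimReal`).
[folklore] -/
def ulimReal (a : ℕ → ℝ) : ℝ :=
  limUnder (U : Filter ℕ) a

variable {U}

/-- A sequence `U`-eventually confined to `[l, u]` converges along `U` to its `U`-limit.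
[folklore] -/
theorem tendsto_ulimReal {a : ℕ → ℝ} {l u : ℝ} (h : ∀ᶠ i in (U : Filter ℕ), a i ∈ Icc l u) :
    Tendsto a U (𝓝 (ulimReal U a)) := by
  have hmem : Icc l u ∈ ((U.map a : Ultrafilter ℝ) : Filter ℝ) := by
    rw [Ultrafilter.mem_coe, Ultrafilter.mem_map]
    exact h
  obtain ⟨c, -, hc⟩ := isCompact_Icc.ultrafilter_le_nhds (U.map a) (Filter.le_principal_iff.2 hmem)
  rw [Ultrafilter.coe_map] at hc
  exact tendsto_nhds_limUnder ⟨c, hc⟩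

/-- A sequence bounded in absolute value converges along `U` to its `U`-limit. [folklore] -/
theorem tendsto_ulimReal_of_abs_le {a : ℕ → ℝ} {C : ℝ} (h : ∀ i, |a i| ≤ C) :
    Tendsto a U (𝓝 (ulimReal U a)) :=
  tendsto_ulimReal (l := -C) (u := C) (Eventually.of_forall fun i ↦ ⟨(abs_le.1 (h i)).1, (abs_le.1 (h i)).2⟩)

/-- The `U`-limit is the limit. [folklore] -/
theorem ulimReal_eq_of_tendsto {a : ℕ → ℝ} {c : ℝ} (h : Tendsto a U (𝓝 c)) : ulimReal U a = c :=
  h.limUnder_eq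

/-- `U`-limit of a constant. [folklore] -/
theorem ulimReal_const (c : ℝ) : ulimReal U (fun _ ↦ c) = c :=
  ulimReal_eq_of_tendsto tendsto_const_nhds

/-- `U`-limits of bounded sequences add. [folklore] -/
theorem ulimReal_add {a b : ℕ → ℝ} {Ca Cb : ℝ} (ha : ∀ i, |a i| ≤ Ca) (hb : ∀ i, |b i| ≤ Cb) :
    ulimReal U (fun i ↦ a i + b i) = ulimReal U a + ulimReal U b :=
  ulimReal_eq_of_tendsto ((tendsto_ulimReal_of_abs_le ha).add (tendsto_ulimReal_of_abs_le hb))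

/-- `U`-limits of bounded sequences are monotone under `U`-almost-everywhere inequality.
[folklore] -/
theorem ulimReal_le_ulimReal {a b : ℕ → ℝ} {Ca Cb : ℝ} (ha : ∀ i, |a i| ≤ Ca) (hb : ∀ i, |b i| ≤ Cb)
    (h : ∀ᶠ i in (U : Filter ℕ), a i ≤ b i) : ulimReal U a ≤ ulimReal U b :=
  le_of_tendsto_of_tendsto (tendsto_ulimReal_of_abs_le ha) (tendsto_ulimReal_of_abs_le hb) h

/-- An upper bound valid `U`-almost everywhere bounds the `U`-limit. [folklore] -/
theorem ulimReal_le_of_eventually_le {a : ℕ → ℝ} {C c : ℝ} (ha : ∀ i, |a i| ≤ C)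
    (h : ∀ᶠ i in (U : Filter ℕ), a i ≤ c) : ulimReal U a ≤ c :=
  le_of_tendsto (tendsto_ulimReal_of_abs_le ha) h

/-- A lower bound valid `U`-almost everywhere bounds the `U`-limit from below. [folklore] -/
theorem le_ulimReal_of_eventually_le {a : ℕ → ℝ} {C c : ℝ} (ha : ∀ i, |a i| ≤ C)
    (h : ∀ᶠ i in (U : Filter ℕ), c ≤ a i) : c ≤ ulimReal U a :=
  ge_of_tendsto (tendsto_ulimReal_of_abs_le ha) h

/-- The `U`-limit of a sequence bounded by `C` is bounded by `C`. [folklore] -/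
theorem abs_ulimReal_le {a : ℕ → ℝ} {C : ℝ} (ha : ∀ i, |a i| ≤ C) : |ulimReal U a| ≤ C :=
  abs_le.2 ⟨le_ulimReal_of_eventually_le ha (Eventually.of_forall fun i ↦ (abs_le.1 (ha i)).1),
    ulimReal_le_of_eventually_le ha (Eventually.of_forall fun i ↦ (abs_le.1 (ha i)).2)⟩

/-- A bounded sequence is `ε`-close to its `U`-limit `U`-almost everywhere. [folklore] -/
theorem eventually_abs_sub_ulimReal_lt {a : ℕ → ℝ} {C : ℝ} (ha : ∀ i, |a i| ≤ C) {ε : ℝ} (hε : 0 < ε) :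
    ∀ᶠ i in (U : Filter ℕ), |a i - ulimReal U a| < ε := by
  have := Metric.tendsto_nhds.1 (tendsto_ulimReal_of_abs_le (U := U) ha) ε hε
  exact this.mono fun i hi ↦ by rwa [Real.dist_eq] at hi

/-- If the `U`-limit of a bounded sequence is `< c`, the sequence is `< c` `U`-almost everywhere.
[folklore] -/
theorem eventually_lt_of_ulimReal_lt {a : ℕ → ℝ} {C c : ℝ} (ha : ∀ i, |a i| ≤ C) (h : ulimReal U a < c) :
    ∀ᶠ i in (U : Filter ℕ), a i < c :=
  (tendsto_ulimReal_of_abs_le ha).eventually (gt_mem_nhds h)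

end ULim

/-! ### §2. Admissible sequences and their pseudometric -/

section Pre

variable {X : ℕ → Type*} [∀ i, PseudoMetricSpace (X i)]

/-- **Admissible sequences** of the pointed spaces `(Xᵢ, pᵢ)`: `xᵢ ∈ Xᵢ` at bounded distance from
the base points. The ultrafilter `U` is a parameter of the type (it determines the pseudometric).
[folklore] -/
structure PreUltralimit (p : ∀ i, X i) (U : Ultrafilter ℕ) where
  /-- the sequence -/
  seq : ∀ i, X i
  /-- at bounded distance from the base points -/
  bdd : ∃ C : ℝ, ∀ i, dist (seq i) (p i) ≤ C

namespace PreUltralimit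

variable {p : ∀ i, X i} {U : Ultrafilter ℕ}

/-- The distance sequences between admissible sequences are bounded. [folklore] -/
theorem exists_abs_dist_le (x y : PreUltralimit p U) :
    ∃ C : ℝ, ∀ i, |dist (x.seq i) (y.seq i)| ≤ C := by
  obtain ⟨Cx, hx⟩ := x.bdd
  obtain ⟨Cy, hy⟩ := y.bdd
  refine ⟨Cx + Cy, fun i ↦ ?_⟩
  rw [abs_of_nonneg dist_nonneg]
  calc dist (x.seq i) (y.seq i) ≤ dist (x.seq i) (p i) + dist (p i) (y.seq i) := dist_triangle _ _ _
    _ ≤ Cx + Cy := by rw [dist_comm (p i)]; exact add_le_add (hx i) (hy i)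

/-- **The ultralimit pseudometric** `d(x, y) = lim_U d(xᵢ, yᵢ)` on admissible sequences.
[folklore] -/
instance instPseudoMetricSpace : PseudoMetricSpace (PreUltralimit p U) where
  dist x y := ulimReal U (fun i ↦ dist (x.seq i) (y.seq i))
  dist_self x := by
    show ulimReal U (fun i ↦ dist (x.seq i) (x.seq i)) = 0
    simp only [dist_self]
    exact ulimReal_const 0
  dist_comm x y := by
    show ulimReal U (fun i ↦ dist (x.seq i) (y.seq i)) = ulimReal U (fun i ↦ dist (y.seq i) (x.seq i))
    simp only [dist_comm]
  dist_triangle x y z := by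
    show ulimReal U (fun i ↦ dist (x.seq i) (z.seq i)) ≤
      ulimReal U (fun i ↦ dist (x.seq i) (y.seq i)) + ulimReal U (fun i ↦ dist (y.seq i) (z.seq i))
    obtain ⟨C₁, h₁⟩ := exists_abs_dist_le x y
    obtain ⟨C₂, h₂⟩ := exists_abs_dist_le y z
    obtain ⟨C₃, h₃⟩ := exists_abs_dist_le x z
    rw [← ulimReal_add h₁ h₂]
    refine ulimReal_le_ulimReal h₃ (Cb := C₁ + C₂) (fun i ↦ ?_) (Eventually.of_forall fun i ↦ dist_triangle _ _ _)
    exact (abs_add_le _ _).trans (add_le_add (h₁ i) (h₂ i))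

/-- Unfolding of the distance. [folklore] -/
theorem dist_def (x y : PreUltralimit p U) :
    dist x y = ulimReal U (fun i ↦ dist (x.seq i) (y.seq i)) :=
  rfl

/-- `d(xᵢ, yᵢ) → d(x, y)` along `U`. [folklore] -/
theorem tendsto_dist (x y : PreUltralimit p U) :
    Tendsto (fun i ↦ dist (x.seq i) (y.seq i)) U (𝓝 (dist x y)) := by
  obtain ⟨C, hC⟩ := exists_abs_dist_le x y
  exact tendsto_ulimReal_of_abs_le hC

/-- `d(xᵢ, yᵢ)` is `ε`-close to `d(x, y)` for `U`-almost all `i`. [folklore] -/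
theorem eventually_abs_dist_sub_lt (x y : PreUltralimit p U) {ε : ℝ} (hε : 0 < ε) :
    ∀ᶠ i in (U : Filter ℕ), |dist (x.seq i) (y.seq i) - dist x y| < ε := by
  obtain ⟨C, hC⟩ := exists_abs_dist_le x y
  exact eventually_abs_sub_ulimReal_lt hC hε

/-- A `U`-almost-everywhere bound `d(xᵢ, yᵢ) ≤ c` gives `d(x, y) ≤ c`. [folklore] -/
theorem dist_le_of_eventually_le {x y : PreUltralimit p U} {c : ℝ}
    (h : ∀ᶠ i in (U : Filter ℕ), dist (x.seq i) (y.seq i) ≤ c) : dist x y ≤ c := by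
  obtain ⟨C, hC⟩ := exists_abs_dist_le x y
  exact ulimReal_le_of_eventually_le hC h

/-- A `U`-almost-everywhere bound `c ≤ d(xᵢ, yᵢ)` gives `c ≤ d(x, y)`. [folklore] -/
theorem le_dist_of_eventually_le {x y : PreUltralimit p U} {c : ℝ}
    (h : ∀ᶠ i in (U : Filter ℕ), c ≤ dist (x.seq i) (y.seq i)) : c ≤ dist x y := by
  obtain ⟨C, hC⟩ := exists_abs_dist_le x y
  exact le_ulimReal_of_eventually_le hC h

/-- If `d(x, y) < c` then `d(xᵢ, yᵢ) < c` for `U`-almost all `i`. [folklore] -/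
theorem eventually_dist_lt {x y : PreUltralimit p U} {c : ℝ} (h : dist x y < c) :
    ∀ᶠ i in (U : Filter ℕ), dist (x.seq i) (y.seq i) < c := by
  obtain ⟨C, hC⟩ := exists_abs_dist_le x y
  exact eventually_lt_of_ulimReal_lt hC h

variable (p U) in
/-- **The base point** `(pᵢ)ᵢ`. [folklore] -/
def base : PreUltralimit p U :=
  ⟨p, 0, fun i ↦ by simp⟩

/-- The base point is the sequence of base points. [folklore] -/
@[simp] theorem base_seq : (base p U).seq = p := rfl

/-- The distance to the base point is the `U`-limit of `d(xᵢ, pᵢ)`. [folklore] -/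
theorem dist_base (x : PreUltralimit p U) : dist x (base p U) = ulimReal U (fun i ↦ dist (x.seq i) (p i)) :=
  rfl

/-- An admissible sequence at distance `≤ C` from the base points everywhere is at distance `≤ C`
from the base point. [folklore] -/
theorem dist_base_le {x : PreUltralimit p U} {C : ℝ} (h : ∀ i, dist (x.seq i) (p i) ≤ C) :
    dist x (base p U) ≤ C :=
  dist_le_of_eventually_le (Eventually.of_forall fun i ↦ by simpa using h i)

/-! ### §3. Completeness -/

/-- **Ultralimits are complete** (for `U` finer than the cofinite filter): every fast Cauchy sequence
`(uⁿ)` of admissible sequences, `d(uⁿ, uᵐ) < 2⁻ᴺ` for `n, m ≥ N`, converges — to the diagonal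
sequence `zᵢ = u^{M(i)}_i`, where `M(i)` is the largest `N ≤ i` such that the finitely many
inequalities `d(uⁿᵢ, uᵏᵢ) < 2 · 2⁻ⁿ`, `n ≤ k ≤ N`, hold at the index `i` (they hold `U`-almost
everywhere for each fixed `N`). [folklore] -/
theorem completeSpace (hU : (U : Filter ℕ) ≤ atTop) : CompleteSpace (PreUltralimit p U) := by
  refine Metric.complete_of_convergent_controlled_sequences (fun n ↦ (1 / 2 : ℝ) ^ n)
    (fun n ↦ by positivity) fun u hu ↦ ?_
  set x : ℕ → ∀ i, X i := fun n ↦ (u n).seq with hx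
  -- the good index sets
  set B : ℕ → Set ℕ := fun N ↦
    {i | ∀ k ≤ N, ∀ n ≤ k, dist (x n i) (x k i) < 2 * (1 / 2 : ℝ) ^ n} with hB
  have hBU : ∀ N, B N ∈ (U : Filter ℕ) := by
    intro N
    have h1 : ∀ k ≤ N, ∀ n ≤ k, ∀ᶠ i in (U : Filter ℕ), dist (x n i) (x k i) < 2 * (1 / 2 : ℝ) ^ n := by
      intro k _ n hnk
      have hd : dist (u n) (u k) < 2 * (1 / 2 : ℝ) ^ n := by
        rcases eq_or_lt_of_le hnk with rfl | hlt
        · rw [_root_.dist_self]; positivity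
        · have := hu n n k le_rfl hlt.le
          have hpos : (0 : ℝ) < (1 / 2) ^ n := by positivity
          linarith
      exact eventually_dist_lt hd
    have h2 : ∀ᶠ i in (U : Filter ℕ), ∀ k ∈ Finset.range (N + 1), ∀ n ∈ Finset.range (k + 1),
        dist (x n i) (x k i) < 2 * (1 / 2 : ℝ) ^ n := by
      rw [Filter.eventually_all_finset]
      intro k hk
      rw [Filter.eventually_all_finset]
      intro n hn
      exact h1 k (Nat.lt_succ_iff.1 (Finset.mem_range.1 hk)) n (Nat.lt_succ_iff.1 (Finset.mem_range.1 hn))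
    refine h2.mono fun i hi k hk n hn ↦ ?_
    exact hi k (Finset.mem_range.2 (Nat.lt_succ_iff.2 hk)) n (Finset.mem_range.2 (Nat.lt_succ_iff.2 hn))
  have hB0 : ∀ i, i ∈ B 0 := fun i k hk n hn ↦ by
    have hk0 : k = 0 := Nat.le_zero.1 hk
    have hn0 : n = 0 := Nat.le_zero.1 (hk0 ▸ hn)
    subst hk0; subst hn0
    simp
  -- the diagonal index `M i` and the limit sequence
  classical
  set M : ℕ → ℕ := fun i ↦ Nat.findGreatest (fun N ↦ i ∈ B N) i with hM
  have hMspec : ∀ i, i ∈ B (M i) := fun i ↦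
    Nat.findGreatest_spec (P := fun N ↦ i ∈ B N) (Nat.zero_le i) (hB0 i)
  have hMge : ∀ n i, n ≤ i → i ∈ B n → n ≤ M i := fun n i hni hi ↦
    Nat.le_findGreatest (P := fun N ↦ i ∈ B N) hni hi
  set z : ∀ i, X i := fun i ↦ x (M i) i with hz
  obtain ⟨C₀, hC₀⟩ := (u 0).bdd
  have hzb : ∀ i, dist (z i) (p i) ≤ 2 + C₀ := fun i ↦ by
    have h1 : dist (x 0 i) (x (M i) i) < 2 * (1 / 2 : ℝ) ^ 0 := hMspec i (M i) le_rfl 0 (Nat.zero_le _)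
    rw [pow_zero, mul_one] at h1
    calc dist (z i) (p i) ≤ dist (z i) (x 0 i) + dist (x 0 i) (p i) := dist_triangle _ _ _
      _ ≤ 2 + C₀ := by
        rw [dist_comm]
        exact add_le_add h1.le (hC₀ i)
  set zz : PreUltralimit p U := ⟨z, 2 + C₀, hzb⟩ with hzz
  refine ⟨zz, ?_⟩
  -- `d(uⁿ, z) ≤ 2 · 2⁻ⁿ`
  have hdist : ∀ n, dist (u n) zz ≤ 2 * (1 / 2 : ℝ) ^ n := fun n ↦ by
    refine dist_le_of_eventually_le ?_
    have hmem : {i | i ∈ B n ∧ n ≤ i} ∈ (U : Filter ℕ) :=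
      inter_mem (hBU n) (hU (Ici_mem_atTop n))
    refine (eventually_of_mem hmem) fun i hi ↦ ?_
    obtain ⟨hin, hni⟩ := hi
    have hnM : n ≤ M i := hMge n i hni hin
    exact (hMspec i (M i) le_rfl n hnM).le
  rw [tendsto_iff_dist_tendsto_zero]
  have h0 : Tendsto (fun n ↦ 2 * (1 / 2 : ℝ) ^ n) atTop (𝓝 0) := by
    simpa using (tendsto_pow_atTop_nhds_zero_of_lt_one (by norm_num : (0 : ℝ) ≤ 1 / 2)
      (by norm_num : (1 / 2 : ℝ) < 1)).const_mul 2
  exact squeeze_zero (fun n ↦ dist_nonneg) hdist h0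

end PreUltralimit

/-! ### §4. The ultralimit as a complete metric space -/

/-- **The ultralimit** `lim_U (Xᵢ, pᵢ)`: the metric quotient of the admissible sequences.
[folklore] -/
abbrev Ultralimit (p : ∀ i, X i) (U : Ultrafilter ℕ) : Type _ :=
  SeparationQuotient (PreUltralimit p U)

namespace Ultralimit

variable {p : ∀ i, X i} {U : Ultrafilter ℕ}

/-- The class of an admissible sequence. [folklore] -/
def mk (x : PreUltralimit p U) : Ultralimit p U :=
  SeparationQuotient.mk x

/-- Every point of the ultralimit is the class of an admissible sequence. [folklore] -/
theorem mk_surjective : Function.Surjective (mk : PreUltralimit p U → Ultralimit p U) :=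
  SeparationQuotient.surjective_mk

/-- Distances are computed on representatives. [folklore] -/
@[simp] theorem dist_mk (x y : PreUltralimit p U) : dist (mk x) (mk y) = dist x y :=
  SeparationQuotient.dist_mk x y

variable (p U) in
/-- **The base point** of the ultralimit. [folklore] -/
def basePt : Ultralimit p U :=
  mk (PreUltralimit.base p U)

/-- The distance of a class to the base point. [folklore] -/
theorem dist_mk_basePt (x : PreUltralimit p U) :
    dist (mk x) (basePt p U) = ulimReal U (fun i ↦ dist (x.seq i) (p i)) :=
  SeparationQuotient.dist_mk _ _

/-- **The ultralimit is complete** (for `U` finer than the cofinite filter). [folklore] -/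
theorem completeSpace (hU : (U : Filter ℕ) ≤ atTop) : CompleteSpace (Ultralimit p U) := by
  haveI := PreUltralimit.completeSpace (p := p) hU
  infer_instance

end Ultralimit

end Pre

end Literature.Geometry.MetricGeometry
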